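import Literature.AlgebraicGeometry.Resolution.LogRegularRefinement
import HarnessLib

/-!
# Kato 1994, (10.3): the refined chart of a complete log regular local ring is regular

`Literature/AlgebraicGeometry/Resolution/LogRegularRefinementRegular.lean`. K. Kato, *Toric
singularities*, Amer. J. Math. 116 (1994), Thm. (10.3)/(10.4): for a regular (free) cone of a
subdivision of a chart `P → 𝒪_X` of a log regular scheme, the refined chart
`X′ = Spec A[T₁,…,T_N]/(φ(p) − T^{c p})` "is regular". PROVED here at the closed point
`𝔔 = (𝔪_A, T)` over the closed point of a COMPLETE Noetherian local ring `A` in the d = 0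
normal form (`𝔪_A` generated by `φ(P ∖ 0)`, `dim A = rank P`): `B_𝔔` is a regular local ring of
dimension `N`. Assembly of `LogRegularCompleteStructure` (Kato (3.1)/(3.2)), `CoefficientDVR`
(Cohen), `LogRegularRefinementModel` (the regular models `Λ⟦T⟧/(θ′)`), `LogRegularRefinementChart`
(`emb.dim B_𝔔 ≤ N`) and `LogRegularRefinement` (the completion sandwich `dim B_𝔔 ≥ N`).

References: [Kato1994] K. Kato, Toric singularities, Amer. J. Math. 116 (1994), (3.1)–(3.2),
(10.3)–(10.4).
-/

noncomputable section

open IsLocalRing MvPowerSeries Literature.RingTheory.MvPowerSeries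
  Literature.RingTheory.MvPowerSeries.monoidPowerSeries
  Literature.RingTheory.CompleteLocalRings

namespace Literature.AlgebraicGeometry.Resolution

namespace LogRegularCompleteStructure

universe u

variable {A : Type u} [CommRing A] [IsLocalRing A] [IsNoetherianRing A]
  [IsAdicComplete (maximalIdeal A) A]
  {M N : ℕ} {P : AddSubmonoid (Fin M →₀ ℕ)}
  {φ : (Fin M →₀ ℕ) → A} {c : (Fin M →₀ ℕ) → (Fin N →₀ ℕ)}

/-- **Dimension of the refined chart** (Kato (10.3), d = 0 normal form, complete `A`):
`dim B_𝔔 ≥ N`, by the completion sandwich with the regular model in either characteristic.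
[cite: Kato1994, (10.3)] -/
theorem le_ringKrullDim_localization_closedPoint (hP : P.FG)
    (hφ0 : φ 0 = 1) (hφadd : ∀ a ∈ P, ∀ b ∈ P, φ (a + b) = φ a * φ b)
    (hφm : ∀ p ∈ P, p ≠ 0 → φ p ∈ maximalIdeal A)
    (hgen : maximalIdeal A ≤ Ideal.span (φ '' {p | p ∈ P ∧ p ≠ 0}))
    (hdim : ringKrullDim A = rank P)
    (hc0 : c 0 = 0) (hadd : ∀ a ∈ P, ∀ b ∈ P, c (a + b) = c a + c b)
    (hc : ∀ p ∈ P, p ≠ 0 → c p ≠ 0)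
    (hfin : ∀ e : Fin N →₀ ℕ, {p : Fin M →₀ ℕ | p ∈ P ∧ c p = e}.Finite) :
    letI := isMaximal_closedPoint hφ0 hφm hc0 hc
    (N : WithBot ℕ∞) ≤ ringKrullDim (Localization.AtPrime (closedPoint φ c P hφ0 hφm hc0 hc)) := by
  classical
  letI := isMaximal_closedPoint hφ0 hφm hc0 hc
  have hker0 : ∀ p ∈ P, c p = 0 → p = 0 := fun p hp h0 => by
    by_contra hne; exact hc p hp hne h0
  obtain ⟨p, hp⟩ := CharP.exists (ResidueField A)
  rcases CharP.char_is_prime_or_zero (ResidueField A) p with hprime | rfl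
  · -- mixed / residue characteristic `p > 0`: Cohen DVR coefficients
    haveI : Fact p.Prime := ⟨hprime⟩
    obtain ⟨R, _, _, _, hRN, hRc, hmax, hp0, j, hres⟩ := exists_cohenDVR_ringHom A p
    haveI := hRN
    haveI := hRc
    have hpA : (p : A) ∈ maximalIdeal A := by
      rw [← residue_eq_zero_iff, map_natCast]
      exact CharP.cast_eq_zero _ p
    haveI : IsLocalHom j := by
      refine ⟨fun r hr => ?_⟩
      by_contra hrn
      have hrm : r ∈ maximalIdeal R := (mem_maximalIdeal _).2 (mem_nonunits_iff.2 hrn)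
      rw [hmax, Ideal.mem_span_singleton] at hrm
      obtain ⟨s, rfl⟩ := hrm
      rw [map_mul, map_natCast] at hr
      exact ((mem_maximalIdeal _).1 (Ideal.mul_mem_right _ _ hpA)) hr
    obtain ⟨ψ, hψsurj, hψmon, hψC⟩ :=
      exists_lift_surjective j hres hP φ hφ0 hφadd hφm hgen
    have hjp : j (p : R) ∈ maximalIdeal A := by rw [map_natCast]; exact hpA
    obtain ⟨θ, hθ, hθπ⟩ := exists_theta ψ hψsurj j hψC φ hψmon hgen (p : R) hjp
    have hker := ker_eq_span_theta hp0 hmax hP ψ hψsurj hdim θ hθ hθπ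
    have hθm : MvPowerSeries.constantCoeff (θ : MvPowerSeries (Fin M) R) ∈ maximalIdeal R := by
      rw [hθπ, hmax]; exact Ideal.subset_span rfl
    have hθ' : MvPowerSeries.constantCoeff
        (pushforward (R := R) c hfin hc0 hadd θ : MvPowerSeries (Fin N) R) = (p : R) := by
      rw [constantCoeff_pushforward c hfin hc0 hadd hker0, hθπ]
    have hmodel := (isRegularLocalRing_model_dvr hp0 hmax _ hθ').2
    rw [← hmodel]
    exact ringKrullDim_model_le hφ0 hφm hc0 hc j hres hgen hfin hadd ψ hψsurj hψmon hψC θ hker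
      hθm _ rfl
  · -- equal characteristic zero: coefficient field
    haveI : CharZero (ResidueField A) := CharP.charP_to_charZero (ResidueField A)
    obtain ⟨σ, hσ⟩ := exists_coefficientField_of_charZero A
    have hbot : maximalIdeal (ResidueField A) = ⊥ :=
      (IsLocalRing.isField_iff_maximalIdeal_eq).1 (Field.toIsField _)
    haveI : IsAdicComplete (maximalIdeal (ResidueField A)) (ResidueField A) := by
      rw [hbot]; infer_instance
    haveI : IsLocalHom σ := by
      refine ⟨fun x hx => ?_⟩
      by_contra hxn
      have hx0 : x = 0 := by
        by_contra h
        exact hxn (Ne.isUnit h)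
      rw [hx0, map_zero] at hx
      exact not_isUnit_zero hx
    have hres : ∀ a : A, ∃ l : ResidueField A, a - σ l ∈ maximalIdeal A := fun a =>
      ⟨residue A a, by rw [← residue_eq_zero_iff, map_sub, hσ, sub_self]⟩
    obtain ⟨ψ, hψsurj, hψmon, hψC⟩ :=
      exists_lift_surjective σ hres hP φ hφ0 hφadd hφm hgen
    have hker : RingHom.ker ψ = Ideal.span {(0 : monoidPowerSeries (ResidueField A) P)} := by
      rw [ker_eq_bot_of_field hP ψ hψsurj hdim, eq_comm, Ideal.span_singleton_eq_bot]
    have hθm : MvPowerSeries.constantCoeff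
        ((0 : monoidPowerSeries (ResidueField A) P) : MvPowerSeries (Fin M) (ResidueField A)) ∈
        maximalIdeal (ResidueField A) := by
      rw [Subalgebra.coe_zero, map_zero]; exact Ideal.zero_mem _
    have hmodel : ringKrullDim (MvPowerSeries (Fin N) (ResidueField A) ⧸
        Ideal.span {(0 : MvPowerSeries (Fin N) (ResidueField A))}) = N := by
      rw [ringKrullDim_eq_of_ringEquiv ((Ideal.quotEquivOfEq
        ((Ideal.span_singleton_eq_bot).2 rfl)).trans (RingEquiv.quotientBot _))]
      exact (isRegularLocalRing_model_field (ResidueField A) N).2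
    rw [← hmodel]
    exact ringKrullDim_model_le hφ0 hφm hc0 hc σ hres hgen hfin hadd ψ hψsurj hψmon hψC 0 hker
      hθm _ (by rw [map_zero])

/-- **Kato 1994, Thm. (10.3) (regular cone, closed point; d = 0 normal form, complete base).**
Let `A` be a complete Noetherian local ring with a chart `φ : P → A` by a finitely generated
monoid `P ⊆ ℕ^{(M)}` such that `φ(P ∖ 0) ⊆ 𝔪_A` generates `𝔪_A` and `dim A = rank P` (log
regularity), and let `c : P → ℕ^N` be additive with `c⁻¹(0) = 0` and finite fibres (a regular
cone of a subdivision, `P ⊆ ℕ^N ⊆ P^{gp}`-style refinement). Then the local ring of the refined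
chart `B = A[T₁,…,T_N]/(φ(p) − T^{c p})` at `𝔔 = (𝔪_A, T)` is a regular local ring of dimension
`N`. [cite: Kato1994, (10.3)] -/
theorem isRegularLocalRing_localization_closedPoint (hP : P.FG)
    (hφ0 : φ 0 = 1) (hφadd : ∀ a ∈ P, ∀ b ∈ P, φ (a + b) = φ a * φ b)
    (hφm : ∀ p ∈ P, p ≠ 0 → φ p ∈ maximalIdeal A)
    (hgen : maximalIdeal A ≤ Ideal.span (φ '' {p | p ∈ P ∧ p ≠ 0}))
    (hdim : ringKrullDim A = rank P)
    (hc0 : c 0 = 0) (hadd : ∀ a ∈ P, ∀ b ∈ P, c (a + b) = c a + c b)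
    (hc : ∀ p ∈ P, p ≠ 0 → c p ≠ 0)
    (hfin : ∀ e : Fin N →₀ ℕ, {p : Fin M →₀ ℕ | p ∈ P ∧ c p = e}.Finite) :
    letI := isMaximal_closedPoint hφ0 hφm hc0 hc
    IsRegularLocalRing (Localization.AtPrime (closedPoint φ c P hφ0 hφm hc0 hc)) ∧
      ringKrullDim (Localization.AtPrime (closedPoint φ c P hφ0 hφm hc0 hc)) = N := by
  letI := isMaximal_closedPoint hφ0 hφm hc0 hc
  have hN := le_ringKrullDim_localization_closedPoint hP hφ0 hφadd hφm hgen hdim hc0 hadd hc hfin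
  have hemb := spanFinrank_maximalIdeal_localization_le hφ0 hφm hc0 hc hgen
  have hemb' : ((maximalIdeal (Localization.AtPrime (closedPoint φ c P hφ0 hφm hc0 hc))).spanFinrank
      : WithBot ℕ∞) ≤ N := by exact_mod_cast hemb
  have hle := ringKrullDim_le_spanFinrank_maximalIdeal
    (Localization.AtPrime (closedPoint φ c P hφ0 hφm hc0 hc))
  exact ⟨IsRegularLocalRing.of_spanFinrank_maximalIdeal_le _ (hemb'.trans hN),
    le_antisymm (hle.trans hemb') hN⟩

end LogRegularCompleteStructure

end Literature.AlgebraicGeometry.Resolution
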